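import Literature.RepresentationTheory.BorelWallach2000.UpqCasimirTensor     -- ★ `upqKVec`, `upqKBasis`, `upqTraceFormK_upqKBasis`, `upqTraceForm`, `uFormGroup`, `torusGen`
import Literature.NumberTheory.Automorphic.GKModulesSmoothVectorsProofs       -- ★ `dπ`, `hasDerivAt_dπ`, `dπ_add_right`, `dπ_smul_right`, `smoothVectors`
import Literature.NumberTheory.Automorphic.UnitaryRepKCasimirBlockBound       -- ★ p829889 (A-p14 (g22), H3a): `upqKCasimirVec`, `upqKBlockScalar`, `inner_upqKCasimirVec_self`
import HarnessLib

/-!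
# The Casimir scalar of a `K`-block dominates the squared torus weight: `μ₁² + ⋯ + μ_n² ≤ n · q`

Topic `NumberTheory/Automorphic`; namespace `Literature.NumberTheory.Automorphic`; THEOREMS ONLY (no `def`, no named fact, no instance, no notation,
no `sorry`).  Cell `hodgecm-mathlib`, F0∕P3, T1a arch line, road HC for the letter A5 ★ `UnitaryGroup.ArchIntegratedOperatorTraceClass` ([Knapp1986,
Thm. 10.2]; [Varadarajan1989, §5.4]): the junction brick **«hq»** of the LEAD's assembly contract (F0P3b-p01 (g2) 2026-08-31T17:25:59Z) — «`∃ δ > 0,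
∀ W ∈ S, δ · (1 + a² + n₁² + n₂²) ≤ 1 + q W`» — in GENERIC form, i.e. everything except the two adapters to the `q` of H3a (A-p14) and the label `w`
of H4b (A-p03), which do not exist yet.

THE PRINT.  [Varadarajan1989, §5.4, Lemma 21 and proof of Thm. 22, pp. 160–161]: with `E = 1 + ω_K`, `ω_K = −Σ_a X_a²` the Casimir of `K` for an
orthonormal basis `(X_a)` of `𝔨`, «`c(ξ) ≥ 1 + |λ|²` where `λ` is the highest weight of `ξ`»; [Knapp1986, proof of Thm. 10.2] the same estimate.  The
mechanism, isolated here: for a SMOOTH vector `v` on which the `𝔨`-Casimir `Q = −Σ_a dπ(w_a)²` of a unitary representation acts by the scalar `q`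
(so that `q‖v‖² = Σ_a ‖dπ(w_a) v‖²` — the positivity identity of H3a, taken as a HYPOTHESIS below) and which is an EIGENVECTOR of the torus one-parameter
groups (`π(exp s u_j) v = e^{s μ_j} v`, `u_j ∈ 𝔨` unit vectors), one has `|μ_j|² ‖v‖² = ‖dπ(u_j) v‖² ≤ Σ_a ‖dπ(w_a) v‖² = q ‖v‖²` — the middle
inequality being CAUCHY–SCHWARZ + PARSEVAL for the expansion `u_j = Σ_a c_a w_a`, `Σ_a c_a² = 1`, valid for ANY orthonormal basis `(w_a)` (no
torus-adapted basis and no basis-independence of the Casimir tensor are needed).  Hence `Σ_j |μ_j|² ≤ n · q` and `(1/n)(1 + Σ_j |μ_j|²) ≤ 1 + q`.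

THE LEAN TEXT.
* §1 (generic linear real group `G`, normed `H`, any `π`): `dπ_sum_smul_right` (linearity of `X ↦ dπ v X` over finite sums);
  `norm_dπ_sq_le_of_eq_sum_smul` (`u = Σ c_a • w_a ⇒ ‖dπ v u‖² ≤ (Σ c_a²) · Σ_a ‖dπ v (w_a)‖²`);
  `dπ_eq_smul_of_forall_apply_expMem` (`π(exp(s u)) v = e^{s μ} v` for all real `s` + differentiable orbit ⇒ `dπ v u = μ • v`, by ★ `hasDerivAt_dπ` and
  uniqueness of derivatives); `norm_sq_le_of_casimir_identity` (`|μ|² ≤ q`), `sum_norm_sq_le_card_mul_of_casimir_identity` (`Σ_j |μ_j|² ≤ #J · q`),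
  `inv_card_mul_one_add_sum_le` (`(#J)⁻¹ (1 + Σ_j |μ_j|²) ≤ 1 + q`).
* §2 (`U(α, β)` = ★ `uFormGroup α β`, the pseudo-orthonormal basis ★ `upqKVec` of `𝔨`, `B(w_a, w_b) = −δ_ab` for `B = Re tr`):
  `upq_coe_eq_sum_repr_smul_upqKVec`, `upqTraceForm_self_eq_neg_sum_repr_sq` (`B(u,u) = −Σ_a c_a²`), **`upq_norm_dπ_sq_le_sum_upqKVec`** (`u ∈ 𝔨`,
  `B(u,u) = −1` ⇒ `‖dπ v u‖² ≤ Σ_a ‖dπ v (upqKVec a)‖²`); the torus directions: `torusGen_mem_kInLie`, `upqTraceForm_torusGen_self`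
  (`B(T_{a,b}, T_{a,b}) = −(Σ a_l² + Σ b_l²)`), so the coordinate generators `torusGen (Pi.single l 1) 0`, `torusGen 0 (Pi.single l 1)` are unit;
  **`upq_sum_weight_sq_le_card_mul_casimir`**: for smooth `v ≠ 0` with `q‖v‖² = Σ_a ‖dπ v (upqKVec a)‖²` and torus eigen-relations with exponents
  `μ : α → ℂ`, `ν : β → ℂ` along the coordinate generators, `Σ_l |μ_l|² + Σ_l |ν_l|² ≤ (|α| + |β|) · q`, and **`upq_inv_card_mul_one_add_weight_sq_le`**:
  `(|α|+|β|)⁻¹ · (1 + Σ|μ_l|² + Σ|ν_l|²) ≤ 1 + q`.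
* §3 (WEIGHT FORM — the shape H4b's «a weight occurs» delivers): `upq_expMem_smul_torusGen` (bridge `exp(s · T_{a,b}) = kV(diag e^{−isa} | diag e^{−isb})`
  over ★ `exp_smul_torusGen`), `upq_apply_expMem_torusGen_single_inl∕inr_of_weight` (an INTEGRAL WEIGHT VECTOR `ϖ(kV(diag z | diag z′)) v = (∏ z_l^{m_l}
  ∏ z′_l^{n_l}) v` is a one-parameter eigenvector with exponents `−i m_l`, `−i n_l`), **`upq_sum_weight_sq_le_card_mul_casimir_of_torusWeight`**:
  `Σ_l m_l² + Σ_l n_l² ≤ (|α|+|β|) · q`, **`upq_inv_card_mul_one_add_weight_sq_le_of_torusWeight`**: `(|α|+|β|)⁻¹ (1 + Σ m_l² + Σ n_l²) ≤ 1 + q`.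
* §4 (BLOCK FORM over H3a ★ p829889, A-p14 (g22)): `upqKBlockScalar_mul_norm_sq` (`q_W ‖v‖² = Σ_a ‖dπ(w_a) v‖²` on a `K`-irreducible block of smooth
  vectors, `q_W = upqKBlockScalar ϖ W`), **`upq_sum_weight_sq_le_card_mul_upqKBlockScalar`** and **`upq_inv_card_mul_one_add_weight_sq_le_one_add_upqKBlockScalar`**:
  `(|α|+|β|)⁻¹ (1 + Σ m_l² + Σ n_l²) ≤ 1 + q_W` for a block containing a non-zero integral torus weight vector — the contract line up to the label re-coding.
* §5 (`U(2,1)`, the LEAD's contract line in H4b's label): **`u21_ninth_mul_one_add_label_sq_le_one_add_upqKBlockScalar`**: for a block with an integral weight vector of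
  torus weight `((m₀, m₁), n₀)` (H4b: `(a+b, b, c)`), `(1/9)(1 + (m₀−m₁)² + m₁² + n₀²) ≤ 1 + q_W` — i.e. `δ = 1/9` for the label `(a, b, c)`.
ADAPTER LEFT FOR THE ASSEMBLY (on the text of H4b): only `(m, n) := ((a+b, b), c)` from A-p03's (D3) highest-weight vector (`Fin.prod_univ_two∕one` if (D3) is
stated with explicit products `(u 0)^(a+b) * (u 1)^b * (u' 0)^c`).
HONEST LABEL: elementary; closes no registered stub by itself.  HC_CM is proved only modulo the 2 remaining named inputs (hLiu418, h413) — behind them the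
booked printed statements + the MOD package — until rung 0 closes.

## References
* V. S. Varadarajan, *An Introduction to Harmonic Analysis on Semisimple Lie Groups*, Cambridge (1989), §5.4, Lemma 21, Thm. 22 (proof, pp. 160–161)
  [Varadarajan1989].
* A. W. Knapp, *Representation Theory of Semisimple Groups: An Overview Based on Examples*, Princeton (1986), Thm. 10.2 (proof) [Knapp1986].
* A. Borel, N. Wallach, *Continuous cohomology, discrete subgroups, and representations of reductive groups*, 2nd ed. (2000), II §1.1 (5) (the
  pseudo-orthonormal basis of `𝔨`) [BorelWallach2000].
-/

set_option autoImplicit false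

noncomputable section

open scoped InnerProductSpace
open Complex (I)

namespace Literature.NumberTheory.Automorphic

open Literature.RepresentationTheory.BorelWallach2000
open Literature.RepresentationTheory.KonnoKonno2007 Literature.RepresentationTheory.KonnoKonno2007.RealDualPair

/-! ## §1 Generic: Cauchy–Schwarz for `dπ`, one-parameter eigenvectors, and the Casimir comparison -/

section Generic

variable {A : Type*} [NormedCommRing A] [NormedAlgebra ℝ A] [NormedAlgebra ℚ A] [CompleteSpace A] [StarRing A]
  {N : Type*} [Fintype N] [DecidableEq N] (G : RealMatrixGroup A N)
  {H : Type*} [NormedAddCommGroup H] [NormedSpace ℂ H] (π : ContRepresentation ℂ G.carrier H)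

/-- `X ↦ dπ v X` is real-linear: it commutes with finite linear combinations. [cite: Varadarajan1989, §5.4 Lemma 21] -/
theorem dπ_sum_smul_right {ι : Type*} (s : Finset ι) (c : ι → ℝ) (w : ι → G.lie) (v : H) :
    dπ G π v (∑ a ∈ s, c a • w a) = ∑ a ∈ s, c a • dπ G π v (w a) := by
  classical
  induction s using Finset.induction_on with
  | empty =>
    rw [Finset.sum_empty, Finset.sum_empty, show (0 : G.lie) = (0 : ℝ) • (0 : G.lie) by rw [zero_smul], dπ_smul_right,
      zero_smul]
  | insert a s ha ih => rw [Finset.sum_insert ha, Finset.sum_insert ha, dπ_add_right, dπ_smul_right, ih]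

/-- **Cauchy–Schwarz for the differential**: if `u = Σ_a c_a • w_a` then `‖dπ v u‖² ≤ (Σ_a c_a²) · Σ_a ‖dπ v (w_a)‖²`.
[cite: Varadarajan1989, §5.4 Lemma 21] -/
theorem norm_dπ_sq_le_of_eq_sum_smul {ι : Type*} [Fintype ι] (w : ι → G.lie) (c : ι → ℝ) {u : G.lie}
    (hu : u = ∑ a, c a • w a) (v : H) :
    ‖dπ G π v u‖ ^ 2 ≤ (∑ a, c a ^ 2) * ∑ a, ‖dπ G π v (w a)‖ ^ 2 := by
  rw [hu, dπ_sum_smul_right]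
  have h1 : ‖∑ a, c a • dπ G π v (w a)‖ ≤ ∑ a, |c a| * ‖dπ G π v (w a)‖ :=
    (norm_sum_le _ _).trans (le_of_eq (Finset.sum_congr rfl fun a _ => by rw [norm_smul, Real.norm_eq_abs]))
  calc ‖∑ a, c a • dπ G π v (w a)‖ ^ 2
      ≤ (∑ a, |c a| * ‖dπ G π v (w a)‖) ^ 2 := pow_le_pow_left₀ (norm_nonneg _) h1 2
    _ ≤ (∑ a, |c a| ^ 2) * ∑ a, ‖dπ G π v (w a)‖ ^ 2 := Finset.sum_mul_sq_le_sq_mul_sq _ _ _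
    _ = (∑ a, c a ^ 2) * ∑ a, ‖dπ G π v (w a)‖ ^ 2 := by simp only [sq_abs]

/-- **One-parameter eigenvectors are eigenvectors of the differential**: if `π(exp(s u)) v = e^{s μ} v` for all real `s` and the `exp`-orbit map
of `v` is differentiable at `0` (e.g. `v` smooth), then `dπ v u = μ • v` (★ `hasDerivAt_dπ` and uniqueness of derivatives).
[cite: Varadarajan1989, §5.4 Lemma 21] [cite: Knapp1986, Thm. 10.2 (proof)] -/
theorem dπ_eq_smul_of_forall_apply_expMem {v : H} (hv : DifferentiableAt ℝ (ExpOrbit.orbit G (realRep G π) v) 0)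
    (u : G.lie) (μ : ℂ) (h : ∀ s : ℝ, π (G.expMem (s • u)) v = Complex.exp ((s : ℂ) * μ) • v) :
    dπ G π v u = μ • v := by
  have h1 : HasDerivAt (fun s : ℝ => Complex.exp ((s : ℂ) * μ) • v) (dπ G π v u) 0 := by
    have h0 := hasDerivAt_dπ G π hv u
    have hfun : (fun s : ℝ => π (G.expMem (s • u)) v) = fun s : ℝ => Complex.exp ((s : ℂ) * μ) • v := funext h
    rw [hfun] at h0
    exact h0
  have h2 : HasDerivAt (fun s : ℝ => Complex.exp ((s : ℂ) * μ) • v) (μ • v) 0 := by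
    have he : HasDerivAt (fun s : ℝ => Complex.exp ((s : ℂ) * μ)) μ 0 := by
      have h3 := ((Complex.ofRealCLM.hasDerivAt (x := (0 : ℝ))).mul_const μ).cexp
      simpa only [Complex.ofRealCLM_apply, Complex.ofReal_zero, zero_mul, Complex.exp_zero, Complex.ofReal_one, one_mul]
        using h3
    exact he.smul_const v
  exact h1.unique h2

/-- The norm form: `‖dπ v u‖ = |μ| ‖v‖` for a one-parameter eigenvector. [cite: Varadarajan1989, §5.4 Lemma 21] -/
theorem norm_dπ_eq_of_forall_apply_expMem {v : H} (hv : DifferentiableAt ℝ (ExpOrbit.orbit G (realRep G π) v) 0)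
    (u : G.lie) (μ : ℂ) (h : ∀ s : ℝ, π (G.expMem (s • u)) v = Complex.exp ((s : ℂ) * μ) • v) :
    ‖dπ G π v u‖ = ‖μ‖ * ‖v‖ := by
  rw [dπ_eq_smul_of_forall_apply_expMem G π hv u μ h, norm_smul]

/-- **The Casimir comparison for one direction**: if `q ‖v‖² = Σ_a ‖dπ v (w_a)‖²` (the positivity identity of the `𝔨`-Casimir on a block, as a
hypothesis), `u = Σ_a c_a • w_a` with `Σ_a c_a² ≤ 1`, and `dπ v u = μ • v` with `v ≠ 0`, then `|μ|² ≤ q`. [cite: Varadarajan1989, §5.4 Lemma 21]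
[cite: Knapp1986, Thm. 10.2 (proof)] -/
theorem norm_sq_le_of_casimir_identity {ι : Type*} [Fintype ι] (w : ι → G.lie) {v : H} (hv0 : v ≠ 0) {q : ℝ}
    (hq : q * ‖v‖ ^ 2 = ∑ a, ‖dπ G π v (w a)‖ ^ 2) {u : G.lie} (c : ι → ℝ) (hu : u = ∑ a, c a • w a)
    (hc : ∑ a, c a ^ 2 ≤ 1) {μ : ℂ} (hμ : dπ G π v u = μ • v) : ‖μ‖ ^ 2 ≤ q := by
  have h := norm_dπ_sq_le_of_eq_sum_smul G π w c hu v
  rw [hμ, norm_smul, mul_pow, ← hq] at h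
  have hvpos : 0 < ‖v‖ ^ 2 := by positivity
  have hS : 0 ≤ q * ‖v‖ ^ 2 := by rw [hq]; positivity
  have h' : ‖μ‖ ^ 2 * ‖v‖ ^ 2 ≤ q * ‖v‖ ^ 2 := h.trans (by nlinarith)
  exact le_of_mul_le_mul_right h' hvpos

/-- **The Casimir comparison for a finite family of directions**: `Σ_j |μ_j|² ≤ #J · q`. [cite: Varadarajan1989, §5.4 Lemma 21] -/
theorem sum_norm_sq_le_card_mul_of_casimir_identity {ι : Type*} [Fintype ι] (w : ι → G.lie) {v : H} (hv0 : v ≠ 0) {q : ℝ}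
    (hq : q * ‖v‖ ^ 2 = ∑ a, ‖dπ G π v (w a)‖ ^ 2) {J : Type*} [Fintype J] (u : J → G.lie) (c : J → ι → ℝ)
    (hu : ∀ j, u j = ∑ a, c j a • w a) (hc : ∀ j, ∑ a, c j a ^ 2 ≤ 1) (μ : J → ℂ) (hμ : ∀ j, dπ G π v (u j) = μ j • v) :
    ∑ j, ‖μ j‖ ^ 2 ≤ (Fintype.card J : ℝ) * q := by
  have h : ∀ j ∈ Finset.univ, ‖μ j‖ ^ 2 ≤ q := fun j _ =>
    norm_sq_le_of_casimir_identity G π w hv0 hq (c j) (hu j) (hc j) (hμ j)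
  calc ∑ j, ‖μ j‖ ^ 2 ≤ ∑ _j : J, q := Finset.sum_le_sum h
    _ = (Fintype.card J : ℝ) * q := by rw [Finset.sum_const, Finset.card_univ, nsmul_eq_mul]

/-- **The contract form**: `(#J)⁻¹ · (1 + Σ_j |μ_j|²) ≤ 1 + q` (for `J` non-empty). [cite: Varadarajan1989, §5.4 Lemma 21] -/
theorem inv_card_mul_one_add_sum_le {ι : Type*} [Fintype ι] (w : ι → G.lie) {v : H} (hv0 : v ≠ 0) {q : ℝ}
    (hq : q * ‖v‖ ^ 2 = ∑ a, ‖dπ G π v (w a)‖ ^ 2) {J : Type*} [Fintype J] [Nonempty J] (u : J → G.lie) (c : J → ι → ℝ)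
    (hu : ∀ j, u j = ∑ a, c j a • w a) (hc : ∀ j, ∑ a, c j a ^ 2 ≤ 1) (μ : J → ℂ) (hμ : ∀ j, dπ G π v (u j) = μ j • v) :
    (Fintype.card J : ℝ)⁻¹ * (1 + ∑ j, ‖μ j‖ ^ 2) ≤ 1 + q := by
  have hJ : (0 : ℝ) < Fintype.card J := by exact_mod_cast Fintype.card_pos
  have hJ1 : (1 : ℝ) ≤ Fintype.card J := by exact_mod_cast Fintype.card_pos
  have h := sum_norm_sq_le_card_mul_of_casimir_identity G π w hv0 hq u c hu hc μ hμ
  have hq0 : 0 ≤ q := by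
    have hS : 0 ≤ q * ‖v‖ ^ 2 := by rw [hq]; positivity
    have hvpos : 0 < ‖v‖ ^ 2 := by positivity
    nlinarith
  rw [inv_mul_le_iff₀ hJ]
  nlinarith

end Generic

/-! ## §2 `U(α, β)`: the pseudo-orthonormal basis `upqKVec` of `𝔨` and the diagonal torus -/

section Upq

variable {α β : Type*} [Fintype α] [DecidableEq α] [Fintype β] [DecidableEq β]

/-- Expansion of `u ∈ 𝔨` in the pseudo-orthonormal basis: `u = Σ_a c_a • w_a` in `𝔤`, `c = (upqKBasis).repr u`.
[cite: BorelWallach2000, II §1.1 (5)] -/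
theorem upq_coe_eq_sum_repr_smul_upqKVec (u : (uFormGroup α β).kInLie) :
    (u : (uFormGroup α β).lie) = ∑ a, (upqKBasis α β).repr u a • upqKVec α β a := by
  have h := congrArg ((uFormGroup α β).kInLie.incl.toLinearMap : (uFormGroup α β).kInLie → (uFormGroup α β).lie)
    ((upqKBasis α β).sum_repr u).symm
  rw [map_sum] at h
  simp only [map_smul] at h
  exact h

/-- `B(u, u) = −Σ_a c_a²` for `u ∈ 𝔨` with coordinates `c` in the pseudo-orthonormal basis (`B(w_a, w_b) = −δ_ab`). [cite: BorelWallach2000, II §1.1 (5)] -/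
theorem upqTraceForm_self_eq_neg_sum_repr_sq (u : (uFormGroup α β).kInLie) :
    upqTraceForm α β (u : (uFormGroup α β).lie) (u : (uFormGroup α β).lie) = -∑ a, ((upqKBasis α β).repr u a) ^ 2 := by
  rw [upq_coe_eq_sum_repr_smul_upqKVec u]
  simp only [LinearMap.BilinForm.sum_left, LinearMap.BilinForm.sum_right, LinearMap.BilinForm.smul_left,
    LinearMap.BilinForm.smul_right, upqTraceForm_upqKVec, mul_ite, mul_neg, mul_one, mul_zero, Finset.sum_ite_eq',
    Finset.mem_univ, if_true, Finset.sum_neg_distrib, sq]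

/-- **Cauchy–Schwarz in `𝔨`**: for a UNIT vector `u ∈ 𝔨` (`B(u,u) = −1`, `B = Re tr`), `‖dπ v u‖² ≤ Σ_a ‖dπ v (upqKVec a)‖²` — for the
pseudo-orthonormal basis ★ `upqKVec` as it stands (no torus-adapted basis needed). [cite: Varadarajan1989, §5.4 Lemma 21] [cite: BorelWallach2000, II §1.1 (5)] -/
theorem upq_norm_dπ_sq_le_sum_upqKVec {H : Type*} [NormedAddCommGroup H] [NormedSpace ℂ H]
    (π : ContRepresentation ℂ (uFormGroup α β).carrier H) (u : (uFormGroup α β).lie) (hu : u ∈ (uFormGroup α β).kInLie)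
    (hunit : upqTraceForm α β u u = -1) (v : H) :
    ‖dπ (uFormGroup α β) π v u‖ ^ 2 ≤ ∑ a, ‖dπ (uFormGroup α β) π v (upqKVec α β a)‖ ^ 2 := by
  have hexp : u = ∑ a, (upqKBasis α β).repr ⟨u, hu⟩ a • upqKVec α β a := upq_coe_eq_sum_repr_smul_upqKVec ⟨u, hu⟩
  have hc : ∑ a, ((upqKBasis α β).repr ⟨u, hu⟩ a) ^ 2 = 1 := by
    have h := upqTraceForm_self_eq_neg_sum_repr_sq (⟨u, hu⟩ : (uFormGroup α β).kInLie)
    change upqTraceForm α β u u = _ at h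
    rw [hunit] at h
    linarith
  have h := norm_dπ_sq_le_of_eq_sum_smul (uFormGroup α β) π (upqKVec α β) (fun a => (upqKBasis α β).repr ⟨u, hu⟩ a) hexp v
  rw [hc, one_mul] at h
  exact h

/-- The torus generators `torusGen a b = diag(−i a_l | −i b_l)` lie in `𝔨` (diagonal with imaginary entries: skew-Hermitian). [folklore]
[cite: BorelWallach2000, II §1.1 (5)] -/
theorem torusGen_mem_kInLie (a : α → ℝ) (b : β → ℝ) :
    (⟨torusGen a b, torusGen_mem_lie a b⟩ : (uFormGroup α β).lie) ∈ (uFormGroup α β).kInLie := by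
  rw [RealMatrixGroup.mem_kInLie_iff, RealMatrixGroup.mem_compactLie_iff]
  refine ⟨torusGen_mem_lie a b, ?_⟩
  change star (torusGen a b) = -torusGen a b
  rw [torusGen, Matrix.star_eq_conjTranspose, Matrix.diagonal_conjTranspose]
  ext x y
  rw [Matrix.neg_apply, Matrix.diagonal_apply, Matrix.diagonal_apply]
  by_cases hxy : x = y
  · rw [if_pos hxy, if_pos hxy, Pi.star_apply]
    rcases x with l | l <;> simp [Complex.conj_ofReal]
  · rw [if_neg hxy, if_neg hxy, neg_zero]

/-- `B(T_{a,b}, T_{a,b}) = −(Σ_l a_l² + Σ_l b_l²)` for the torus generator `T_{a,b} = diag(−i a_l | −i b_l)` and `B = Re tr`. [folklore]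
[cite: BorelWallach2000, II §1.1 (5)] -/
theorem upqTraceForm_torusGen_self (a : α → ℝ) (b : β → ℝ) :
    upqTraceForm α β ⟨torusGen a b, torusGen_mem_lie a b⟩ ⟨torusGen a b, torusGen_mem_lie a b⟩ = -(∑ l, a l ^ 2 + ∑ l, b l ^ 2) := by
  rw [upqTraceForm_apply]
  change ((torusGen a b * torusGen a b).trace).re = _
  rw [torusGen, Matrix.diagonal_mul_diagonal, Matrix.trace_diagonal, Fintype.sum_sum_type, Complex.add_re, Complex.re_sum,
    Complex.re_sum]
  simp only [Sum.elim_inl, Sum.elim_inr, Complex.mul_re, neg_mul, mul_neg, neg_neg,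
    Complex.mul_im, Complex.ofReal_re, Complex.ofReal_im, Complex.I_re, Complex.I_im, mul_zero, mul_one, sub_zero,
    add_zero, zero_sub, sq, neg_add, Finset.sum_neg_distrib]

/-- The coordinate torus generator `diag(0, …, −i, …, 0 | 0)` (at `l : α`) is a unit vector: `B = −1`. [folklore] [cite: BorelWallach2000, II §1.1 (5)] -/
theorem upqTraceForm_torusGen_single_inl (l : α) :
    upqTraceForm α β ⟨torusGen (Pi.single l 1) 0, torusGen_mem_lie _ _⟩ ⟨torusGen (Pi.single l 1) 0, torusGen_mem_lie _ _⟩ = -1 := by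
  rw [upqTraceForm_torusGen_self]
  simp [Pi.single_apply, Finset.sum_ite_eq', sq]

/-- The coordinate torus generator `diag(0 | 0, …, −i, …, 0)` (at `l : β`) is a unit vector: `B = −1`. [folklore] [cite: BorelWallach2000, II §1.1 (5)] -/
theorem upqTraceForm_torusGen_single_inr (l : β) :
    upqTraceForm α β ⟨torusGen 0 (Pi.single l 1), torusGen_mem_lie _ _⟩ ⟨torusGen 0 (Pi.single l 1), torusGen_mem_lie _ _⟩ = -1 := by
  rw [upqTraceForm_torusGen_self]
  simp [Pi.single_apply, Finset.sum_ite_eq', sq]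


/-- **Bridge to the block-diagonal torus of `U(α) × U(β)`** (★ `exp_smul_torusGen`): the one-parameter group of the torus generator is
`exp(s · T_{a,b}) = kV(diag e^{−i s a_l}, diag e^{−i s b_l})` as elements of `U(α, β)` — so a vector `v` with `ϖ(kV(diag z, diag z′)) v = (∏ z_l^{m_l} ∏ z′_l^{n_l}) v`
satisfies the eigen-hypotheses of `upq_sum_weight_sq_le_card_mul_casimir` with `μ_l = −i m_l`, `ν_l = −i n_l`. [folklore] [cite: Varadarajan1989, §5.4 Lemma 21] -/
theorem upq_coe_expMem_smul_torusGen (a : α → ℝ) (b : β → ℝ) (s : ℝ) :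
    (((uFormGroup α β).expMem (s • ⟨torusGen a b, torusGen_mem_lie a b⟩) : GL (α ⊕ β) ℂ) : Matrix (α ⊕ β) (α ⊕ β) ℂ) =
      (((RealDualPair.UForm.kV α β (Literature.Analysis.SegalBargmann.diagHom (Literature.Analysis.SegalBargmann.torusPt (s • a)),
          Literature.Analysis.SegalBargmann.diagHom (Literature.Analysis.SegalBargmann.torusPt (s • b))) : RealDualPair.UForm α β) :
        GL (α ⊕ β) ℂ) : Matrix (α ⊕ β) (α ⊕ β) ℂ) := by
  rw [RealMatrixGroup.coe_expMem, coe_expGL]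
  exact exp_smul_torusGen a b s

/-- The same bridge as an equality IN THE GROUP `U(α, β)` (the carrier type of ★ `uFormGroup`). [folklore] [cite: Varadarajan1989, §5.4 Lemma 21] -/
theorem upq_expMem_smul_torusGen (a : α → ℝ) (b : β → ℝ) (s : ℝ) :
    (uFormGroup α β).expMem (s • ⟨torusGen a b, torusGen_mem_lie a b⟩) =
      RealDualPair.UForm.kV α β (Literature.Analysis.SegalBargmann.diagHom (Literature.Analysis.SegalBargmann.torusPt (s • a)),
        Literature.Analysis.SegalBargmann.diagHom (Literature.Analysis.SegalBargmann.torusPt (s • b))) :=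
  Subtype.ext (Units.ext (upq_coe_expMem_smul_torusGen a b s))

/-- **«hq» for `U(α, β)`, generic form**: let `v ≠ 0` be a SMOOTH vector with `q ‖v‖² = Σ_a ‖dπ(w_a) v‖²` (the positivity identity of the
`𝔨`-Casimir scalar `q` on `v`'s block, as a hypothesis) which is an eigenvector of the coordinate torus one-parameter groups:
`π(exp(s · diag(…, −i, …))) v = e^{s μ_l} v` (`l : α`), resp. `e^{s ν_l} v` (`l : β`).  Then `Σ_l |μ_l|² + Σ_l |ν_l|² ≤ (|α| + |β|) · q`.
[cite: Varadarajan1989, §5.4 Lemma 21] [cite: Knapp1986, Thm. 10.2 (proof)] -/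
theorem upq_sum_weight_sq_le_card_mul_casimir {H : Type*} [NormedAddCommGroup H] [NormedSpace ℂ H]
    (π : ContRepresentation ℂ (uFormGroup α β).carrier H) {v : H} (hv : v ∈ smoothVectors (uFormGroup α β) π) (hv0 : v ≠ 0)
    {q : ℝ} (hq : q * ‖v‖ ^ 2 = ∑ a, ‖dπ (uFormGroup α β) π v (upqKVec α β a)‖ ^ 2) (μ : α → ℂ) (ν : β → ℂ)
    (hμ : ∀ (l : α) (s : ℝ), π ((uFormGroup α β).expMem (s • ⟨torusGen (Pi.single l 1) 0, torusGen_mem_lie _ _⟩)) v =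
      Complex.exp ((s : ℂ) * μ l) • v)
    (hν : ∀ (l : β) (s : ℝ), π ((uFormGroup α β).expMem (s • ⟨torusGen 0 (Pi.single l 1), torusGen_mem_lie _ _⟩)) v =
      Complex.exp ((s : ℂ) * ν l) • v) :
    ∑ l, ‖μ l‖ ^ 2 + ∑ l, ‖ν l‖ ^ 2 ≤ (Fintype.card α + Fintype.card β : ℝ) * q := by
  have hd := differentiableAt_of_mem_smoothVectors (uFormGroup α β) π hv
  -- the family of coordinate torus generators, indexed by `α ⊕ β`
  let u : α ⊕ β → (uFormGroup α β).lie :=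
    Sum.elim (fun l => ⟨torusGen (Pi.single l 1) 0, torusGen_mem_lie _ _⟩) (fun l => ⟨torusGen 0 (Pi.single l 1), torusGen_mem_lie _ _⟩)
  have hu_mem : ∀ j, u j ∈ (uFormGroup α β).kInLie := by
    rintro (l | l)
    · exact torusGen_mem_kInLie _ _
    · exact torusGen_mem_kInLie _ _
  have hu_unit : ∀ j, upqTraceForm α β (u j) (u j) = -1 := by
    rintro (l | l)
    · exact upqTraceForm_torusGen_single_inl l
    · exact upqTraceForm_torusGen_single_inr l
  let c : α ⊕ β → Fin (upqKDim α β) → ℝ := fun j a => (upqKBasis α β).repr ⟨u j, hu_mem j⟩ a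
  have hexp : ∀ j, u j = ∑ a, c j a • upqKVec α β a := fun j => upq_coe_eq_sum_repr_smul_upqKVec ⟨u j, hu_mem j⟩
  have hc : ∀ j, ∑ a, c j a ^ 2 ≤ 1 := by
    intro j
    have h := upqTraceForm_self_eq_neg_sum_repr_sq (⟨u j, hu_mem j⟩ : (uFormGroup α β).kInLie)
    change upqTraceForm α β (u j) (u j) = _ at h
    rw [hu_unit j] at h
    exact le_of_eq (by linarith)
  have hμν : ∀ j, dπ (uFormGroup α β) π v (u j) = Sum.elim μ ν j • v := by
    rintro (l | l)
    · exact dπ_eq_smul_of_forall_apply_expMem (uFormGroup α β) π hd _ (μ l) (hμ l)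
    · exact dπ_eq_smul_of_forall_apply_expMem (uFormGroup α β) π hd _ (ν l) (hν l)
  have h := sum_norm_sq_le_card_mul_of_casimir_identity (uFormGroup α β) π (upqKVec α β) hv0 hq u c hexp hc (Sum.elim μ ν) hμν
  rw [Fintype.sum_sum_type, Fintype.card_sum, Nat.cast_add] at h
  simpa only [Sum.elim_inl, Sum.elim_inr] using h

/-- **«hq», contract form**: under the hypotheses of `upq_sum_weight_sq_le_card_mul_casimir` (and `|α| + |β| ≠ 0`),
`(|α|+|β|)⁻¹ · (1 + Σ_l |μ_l|² + Σ_l |ν_l|²) ≤ 1 + q` — so for `U(2,1)`, `δ = 1/3` serves in «`δ · (1 + |weight|²) ≤ 1 + q_W`» before the affine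
re-coding of the weight into the label. [cite: Varadarajan1989, §5.4 Lemma 21] [cite: Knapp1986, Thm. 10.2 (proof)] -/
theorem upq_inv_card_mul_one_add_weight_sq_le {H : Type*} [NormedAddCommGroup H] [NormedSpace ℂ H]
    (π : ContRepresentation ℂ (uFormGroup α β).carrier H) {v : H} (hv : v ∈ smoothVectors (uFormGroup α β) π) (hv0 : v ≠ 0)
    {q : ℝ} (hq : q * ‖v‖ ^ 2 = ∑ a, ‖dπ (uFormGroup α β) π v (upqKVec α β a)‖ ^ 2) (μ : α → ℂ) (ν : β → ℂ)
    (hμ : ∀ (l : α) (s : ℝ), π ((uFormGroup α β).expMem (s • ⟨torusGen (Pi.single l 1) 0, torusGen_mem_lie _ _⟩)) v =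
      Complex.exp ((s : ℂ) * μ l) • v)
    (hν : ∀ (l : β) (s : ℝ), π ((uFormGroup α β).expMem (s • ⟨torusGen 0 (Pi.single l 1), torusGen_mem_lie _ _⟩)) v =
      Complex.exp ((s : ℂ) * ν l) • v)
    (hcard : 0 < Fintype.card α + Fintype.card β) :
    (Fintype.card α + Fintype.card β : ℝ)⁻¹ * (1 + (∑ l, ‖μ l‖ ^ 2 + ∑ l, ‖ν l‖ ^ 2)) ≤ 1 + q := by
  have h := upq_sum_weight_sq_le_card_mul_casimir π hv hv0 hq μ ν hμ hν
  have hn : (0 : ℝ) < Fintype.card α + Fintype.card β := by exact_mod_cast hcard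
  have hn1 : (1 : ℝ) ≤ Fintype.card α + Fintype.card β := by exact_mod_cast hcard
  have hq0 : 0 ≤ q := by
    have hS : 0 ≤ q * ‖v‖ ^ 2 := by rw [hq]; positivity
    have hvpos : 0 < ‖v‖ ^ 2 := by positivity
    nlinarith
  rw [inv_mul_le_iff₀ hn]
  nlinarith


/-! ## §3 The weight form: an integral torus weight vector `ϖ(diag(z | z′)) v = z^m z′^n · v` -/

/-- **The coordinate one-parameter groups act on a torus WEIGHT VECTOR by `e^{−i s m_l}`**: if `π(kV(diag z, diag z′)) v = (∏ z_l^{m_l} ∏ z′_l^{n_l}) v` for all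
`z ∈ U(1)^α`, `z′ ∈ U(1)^β` (an integral weight vector of the block-diagonal torus), then along `exp(s · diag(…, −i, … | 0))` (coordinate `l : α`) the vector
`v` is an eigenvector with exponent `μ_l = −i m_l`. [folklore] [cite: Varadarajan1989, §5.4 Lemma 21] -/
theorem upq_apply_expMem_torusGen_single_inl_of_weight {H : Type*} [NormedAddCommGroup H] [NormedSpace ℂ H]
    (π : ContRepresentation ℂ (uFormGroup α β).carrier H) {v : H} (m : α → ℤ) (n : β → ℤ)
    (hw : ∀ (z : α → Circle) (z' : β → Circle),
      π (RealDualPair.UForm.kV α β (Literature.Analysis.SegalBargmann.diagHom z, Literature.Analysis.SegalBargmann.diagHom z')) v =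
        ((∏ l, ((z l : Circle) : ℂ) ^ (m l)) * ∏ l, ((z' l : Circle) : ℂ) ^ (n l)) • v)
    (l : α) (s : ℝ) :
    π ((uFormGroup α β).expMem (s • ⟨torusGen (Pi.single l 1) 0, torusGen_mem_lie _ _⟩)) v =
      Complex.exp ((s : ℂ) * (-((m l : ℂ) * I))) • v := by
  rw [upq_expMem_smul_torusGen, hw]
  congr 1
  have h1 : ∀ l' : α, ((Literature.Analysis.SegalBargmann.torusPt (s • Pi.single l (1 : ℝ)) l' : Circle) : ℂ) ^ (m l') =
      if l' = l then Complex.exp (-(s : ℂ) * I) ^ (m l) else 1 := by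
    intro l'
    simp only [Literature.Analysis.SegalBargmann.torusPt, Pi.smul_apply, Pi.single_apply, smul_eq_mul, mul_ite, mul_one, mul_zero]
    split_ifs with h
    · subst h
      rw [Circle.coe_exp]
      push_cast
      ring_nf
    · rw [neg_zero, Circle.exp_zero, Circle.coe_one, one_zpow]
  have h2 : ∀ l' : β, ((Literature.Analysis.SegalBargmann.torusPt (s • (0 : β → ℝ)) l' : Circle) : ℂ) ^ (n l') = 1 := by
    intro l'
    simp only [Literature.Analysis.SegalBargmann.torusPt, Pi.smul_apply, Pi.zero_apply, smul_eq_mul, mul_zero, neg_zero,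
      Circle.exp_zero, Circle.coe_one, one_zpow]
  simp_rw [h1, h2]
  rw [Finset.prod_ite_eq' Finset.univ l, if_pos (Finset.mem_univ l), Finset.prod_const_one, mul_one, ← Complex.exp_int_mul]
  congr 1
  ring

/-- The same along the coordinate `l : β`: exponent `ν_l = −i n_l`. [folklore] [cite: Varadarajan1989, §5.4 Lemma 21] -/
theorem upq_apply_expMem_torusGen_single_inr_of_weight {H : Type*} [NormedAddCommGroup H] [NormedSpace ℂ H]
    (π : ContRepresentation ℂ (uFormGroup α β).carrier H) {v : H} (m : α → ℤ) (n : β → ℤ)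
    (hw : ∀ (z : α → Circle) (z' : β → Circle),
      π (RealDualPair.UForm.kV α β (Literature.Analysis.SegalBargmann.diagHom z, Literature.Analysis.SegalBargmann.diagHom z')) v =
        ((∏ l, ((z l : Circle) : ℂ) ^ (m l)) * ∏ l, ((z' l : Circle) : ℂ) ^ (n l)) • v)
    (l : β) (s : ℝ) :
    π ((uFormGroup α β).expMem (s • ⟨torusGen 0 (Pi.single l 1), torusGen_mem_lie _ _⟩)) v =
      Complex.exp ((s : ℂ) * (-((n l : ℂ) * I))) • v := by
  rw [upq_expMem_smul_torusGen, hw]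
  congr 1
  have h1 : ∀ l' : β, ((Literature.Analysis.SegalBargmann.torusPt (s • Pi.single l (1 : ℝ)) l' : Circle) : ℂ) ^ (n l') =
      if l' = l then Complex.exp (-(s : ℂ) * I) ^ (n l) else 1 := by
    intro l'
    simp only [Literature.Analysis.SegalBargmann.torusPt, Pi.smul_apply, Pi.single_apply, smul_eq_mul, mul_ite, mul_one, mul_zero]
    split_ifs with h
    · subst h
      rw [Circle.coe_exp]
      push_cast
      ring_nf
    · rw [neg_zero, Circle.exp_zero, Circle.coe_one, one_zpow]
  have h2 : ∀ l' : α, ((Literature.Analysis.SegalBargmann.torusPt (s • (0 : α → ℝ)) l' : Circle) : ℂ) ^ (m l') = 1 := by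
    intro l'
    simp only [Literature.Analysis.SegalBargmann.torusPt, Pi.smul_apply, Pi.zero_apply, smul_eq_mul, mul_zero, neg_zero,
      Circle.exp_zero, Circle.coe_one, one_zpow]
  simp_rw [h1, h2]
  rw [Finset.prod_ite_eq' Finset.univ l, if_pos (Finset.mem_univ l), Finset.prod_const_one, one_mul, ← Complex.exp_int_mul]
  congr 1
  ring

/-- **«hq», WEIGHT FORM** (the shape H4b's (D3) «a weight occurs» delivers): for a smooth `v ≠ 0` with Casimir identity `q‖v‖² = Σ_a ‖dπ(w_a) v‖²` which is an
INTEGRAL WEIGHT VECTOR of the block-diagonal torus, `ϖ(diag(z | z′)) v = (∏ z_l^{m_l} ∏ z′_l^{n_l}) v`, one has `Σ_l m_l² + Σ_l n_l² ≤ (|α| + |β|) · q`.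
[cite: Varadarajan1989, §5.4 Lemma 21] [cite: Knapp1986, Thm. 10.2 (proof)] -/
theorem upq_sum_weight_sq_le_card_mul_casimir_of_torusWeight {H : Type*} [NormedAddCommGroup H] [NormedSpace ℂ H]
    (π : ContRepresentation ℂ (uFormGroup α β).carrier H) {v : H} (hv : v ∈ smoothVectors (uFormGroup α β) π) (hv0 : v ≠ 0)
    {q : ℝ} (hq : q * ‖v‖ ^ 2 = ∑ a, ‖dπ (uFormGroup α β) π v (upqKVec α β a)‖ ^ 2) (m : α → ℤ) (n : β → ℤ)
    (hw : ∀ (z : α → Circle) (z' : β → Circle),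
      π (RealDualPair.UForm.kV α β (Literature.Analysis.SegalBargmann.diagHom z, Literature.Analysis.SegalBargmann.diagHom z')) v =
        ((∏ l, ((z l : Circle) : ℂ) ^ (m l)) * ∏ l, ((z' l : Circle) : ℂ) ^ (n l)) • v) :
    ∑ l, ((m l : ℝ)) ^ 2 + ∑ l, ((n l : ℝ)) ^ 2 ≤ (Fintype.card α + Fintype.card β : ℝ) * q := by
  have h := upq_sum_weight_sq_le_card_mul_casimir π hv hv0 hq (fun l => -((m l : ℂ) * I)) (fun l => -((n l : ℂ) * I))
    (upq_apply_expMem_torusGen_single_inl_of_weight π m n hw) (upq_apply_expMem_torusGen_single_inr_of_weight π m n hw)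
  have hm : ∀ l, ‖-((m l : ℂ) * I)‖ ^ 2 = ((m l : ℝ)) ^ 2 := fun l => by
    rw [norm_neg, norm_mul, Complex.norm_I, mul_one, Complex.norm_intCast, sq_abs]
  have hn : ∀ l, ‖-((n l : ℂ) * I)‖ ^ 2 = ((n l : ℝ)) ^ 2 := fun l => by
    rw [norm_neg, norm_mul, Complex.norm_I, mul_one, Complex.norm_intCast, sq_abs]
  simp only [hm, hn] at h
  exact h

/-- **«hq», WEIGHT FORM, contract shape**: `(|α|+|β|)⁻¹ · (1 + Σ_l m_l² + Σ_l n_l²) ≤ 1 + q` for an integral torus weight vector (`|α| + |β| ≠ 0`).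
[cite: Varadarajan1989, §5.4 Lemma 21] [cite: Knapp1986, Thm. 10.2 (proof)] -/
theorem upq_inv_card_mul_one_add_weight_sq_le_of_torusWeight {H : Type*} [NormedAddCommGroup H] [NormedSpace ℂ H]
    (π : ContRepresentation ℂ (uFormGroup α β).carrier H) {v : H} (hv : v ∈ smoothVectors (uFormGroup α β) π) (hv0 : v ≠ 0)
    {q : ℝ} (hq : q * ‖v‖ ^ 2 = ∑ a, ‖dπ (uFormGroup α β) π v (upqKVec α β a)‖ ^ 2) (m : α → ℤ) (n : β → ℤ)
    (hw : ∀ (z : α → Circle) (z' : β → Circle),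
      π (RealDualPair.UForm.kV α β (Literature.Analysis.SegalBargmann.diagHom z, Literature.Analysis.SegalBargmann.diagHom z')) v =
        ((∏ l, ((z l : Circle) : ℂ) ^ (m l)) * ∏ l, ((z' l : Circle) : ℂ) ^ (n l)) • v)
    (hcard : 0 < Fintype.card α + Fintype.card β) :
    (Fintype.card α + Fintype.card β : ℝ)⁻¹ * (1 + (∑ l, ((m l : ℝ)) ^ 2 + ∑ l, ((n l : ℝ)) ^ 2)) ≤ 1 + q := by
  have h := upq_sum_weight_sq_le_card_mul_casimir_of_torusWeight π hv hv0 hq m n hw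
  have hn0 : (0 : ℝ) < Fintype.card α + Fintype.card β := by exact_mod_cast hcard
  have hn1 : (1 : ℝ) ≤ Fintype.card α + Fintype.card β := by exact_mod_cast hcard
  have hq0 : 0 ≤ q := by
    have hS : 0 ≤ q * ‖v‖ ^ 2 := by rw [hq]; positivity
    have hvpos : 0 < ‖v‖ ^ 2 := by positivity
    nlinarith
  rw [inv_mul_le_iff₀ hn0]
  nlinarith

end Upq

/-! ## §4 BLOCK FORM over H3a (★ p829889): the Casimir scalar `q_W = upqKBlockScalar ϖ W` of a `K`-irreducible block -/

section Block

variable {α β : Type*} [Fintype α] [DecidableEq α] [Fintype β] [DecidableEq β]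
  {E : Type*} [NormedAddCommGroup E] [InnerProductSpace ℂ E] [CompleteSpace E]
  (π : ContRepresentation ℂ (uFormGroup α β).carrier E)

/-- **The Casimir identity in H3a's currency**: on a `K`-irreducible block `W` of smooth vectors, `q_W ‖v‖² = Σ_a ‖dπ(w_a) v‖²` for `v ∈ W`, where
`q_W = upqKBlockScalar ϖ W` (★ `upqKCasimirVec_eq_upqKBlockScalar_smul` + ★ `inner_upqKCasimirVec_self`). [cite: Varadarajan1989, §5.4 (proof of Thm. 22)]
[cite: Knapp1986, Thm. 10.2, (10.4)–(10.6)] -/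
theorem upqKBlockScalar_mul_norm_sq (W : Submodule ℂ E) [FiniteDimensional ℂ W] (hu : π.IsUnitary) (hc : π.IsStronglyContinuous)
    (hWs : W ≤ smoothVectors (uFormGroup α β) π)
    (hWK : ∀ (k : (uFormGroup α β).maximalCompact) (v : E), v ∈ W →
      π (Subgroup.inclusion (uFormGroup α β).maximalCompact_le_carrier k) v ∈ W)
    (hWirr : ∀ W' : Submodule ℂ E, W' ≤ W →
      (∀ (k : (uFormGroup α β).maximalCompact) (v : E), v ∈ W' →
        π (Subgroup.inclusion (uFormGroup α β).maximalCompact_le_carrier k) v ∈ W') → W' = ⊥ ∨ W' = W)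
    {v : E} (hv : v ∈ W) :
    upqKBlockScalar π W * ‖v‖ ^ 2 = ∑ a, ‖dπ (uFormGroup α β) π v (upqKVec α β a)‖ ^ 2 := by
  have h1 := inner_upqKCasimirVec_self π hu hc (hWs hv)
  rw [upqKCasimirVec_eq_upqKBlockScalar_smul π W hu hc hWs hWK hWirr hv, inner_smul_left, Complex.conj_ofReal,
    inner_self_eq_norm_sq_to_K] at h1
  apply Complex.ofReal_injective
  rw [Complex.ofReal_mul, Complex.ofReal_pow, Complex.ofReal_sum]
  exact h1

/-- **«hq» IN BLOCK FORM**: for a `K`-irreducible block `W` of smooth vectors (H3a's hypotheses) containing a non-zero INTEGRAL WEIGHT VECTOR of the block-diagonal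
torus (H4b's «a weight occurs»: `ϖ(kV(diag z | diag z′)) v = (∏ z_l^{m_l} ∏ z′_l^{n_l}) v`), `Σ_l m_l² + Σ_l n_l² ≤ (|α| + |β|) · q_W`.
[cite: Varadarajan1989, §5.4 Lemma 21] [cite: Knapp1986, Thm. 10.2 (proof)] -/
theorem upq_sum_weight_sq_le_card_mul_upqKBlockScalar (W : Submodule ℂ E) [FiniteDimensional ℂ W] (hu : π.IsUnitary)
    (hc : π.IsStronglyContinuous) (hWs : W ≤ smoothVectors (uFormGroup α β) π)
    (hWK : ∀ (k : (uFormGroup α β).maximalCompact) (v : E), v ∈ W →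
      π (Subgroup.inclusion (uFormGroup α β).maximalCompact_le_carrier k) v ∈ W)
    (hWirr : ∀ W' : Submodule ℂ E, W' ≤ W →
      (∀ (k : (uFormGroup α β).maximalCompact) (v : E), v ∈ W' →
        π (Subgroup.inclusion (uFormGroup α β).maximalCompact_le_carrier k) v ∈ W') → W' = ⊥ ∨ W' = W)
    {v : E} (hv : v ∈ W) (hv0 : v ≠ 0) (m : α → ℤ) (n : β → ℤ)
    (hw : ∀ (z : α → Circle) (z' : β → Circle),
      π (RealDualPair.UForm.kV α β (Literature.Analysis.SegalBargmann.diagHom z, Literature.Analysis.SegalBargmann.diagHom z')) v =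
        ((∏ l, ((z l : Circle) : ℂ) ^ (m l)) * ∏ l, ((z' l : Circle) : ℂ) ^ (n l)) • v) :
    ∑ l, ((m l : ℝ)) ^ 2 + ∑ l, ((n l : ℝ)) ^ 2 ≤ (Fintype.card α + Fintype.card β : ℝ) * upqKBlockScalar π W :=
  upq_sum_weight_sq_le_card_mul_casimir_of_torusWeight π (hWs hv) hv0 (upqKBlockScalar_mul_norm_sq π W hu hc hWs hWK hWirr hv) m n hw

/-- **«hq» IN BLOCK FORM, contract shape**: `(|α|+|β|)⁻¹ · (1 + Σ_l m_l² + Σ_l n_l²) ≤ 1 + q_W` (`q_W = upqKBlockScalar ϖ W`; `|α| + |β| ≠ 0`) — for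
`U(2,1)` the LEAD's «`δ · (1 + |weight|²) ≤ 1 + q W`» with `δ = 1/3`, before the affine re-coding of the weight `(m₀, m₁, n₀)` into the label `(a, n₁, n₂)`.
[cite: Varadarajan1989, §5.4 Lemma 21] [cite: Knapp1986, Thm. 10.2 (proof)] -/
theorem upq_inv_card_mul_one_add_weight_sq_le_one_add_upqKBlockScalar (W : Submodule ℂ E) [FiniteDimensional ℂ W] (hu : π.IsUnitary)
    (hc : π.IsStronglyContinuous) (hWs : W ≤ smoothVectors (uFormGroup α β) π)
    (hWK : ∀ (k : (uFormGroup α β).maximalCompact) (v : E), v ∈ W →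
      π (Subgroup.inclusion (uFormGroup α β).maximalCompact_le_carrier k) v ∈ W)
    (hWirr : ∀ W' : Submodule ℂ E, W' ≤ W →
      (∀ (k : (uFormGroup α β).maximalCompact) (v : E), v ∈ W' →
        π (Subgroup.inclusion (uFormGroup α β).maximalCompact_le_carrier k) v ∈ W') → W' = ⊥ ∨ W' = W)
    {v : E} (hv : v ∈ W) (hv0 : v ≠ 0) (m : α → ℤ) (n : β → ℤ)
    (hw : ∀ (z : α → Circle) (z' : β → Circle),
      π (RealDualPair.UForm.kV α β (Literature.Analysis.SegalBargmann.diagHom z, Literature.Analysis.SegalBargmann.diagHom z')) v =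
        ((∏ l, ((z l : Circle) : ℂ) ^ (m l)) * ∏ l, ((z' l : Circle) : ℂ) ^ (n l)) • v)
    (hcard : 0 < Fintype.card α + Fintype.card β) :
    (Fintype.card α + Fintype.card β : ℝ)⁻¹ * (1 + (∑ l, ((m l : ℝ)) ^ 2 + ∑ l, ((n l : ℝ)) ^ 2)) ≤ 1 + upqKBlockScalar π W :=
  upq_inv_card_mul_one_add_weight_sq_le_of_torusWeight π (hWs hv) hv0 (upqKBlockScalar_mul_norm_sq π W hu hc hWs hWK hWirr hv) m n hw hcard

end Block

/-! ## §5 `U(2,1)`: the contract line in the label `(a, b, c) = (m₀ − m₁, m₁, n₀)` of H4b -/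

section U21

variable {E : Type*} [NormedAddCommGroup E] [InnerProductSpace ℂ E] [CompleteSpace E]
  (π : ContRepresentation ℂ (uFormGroup (Fin 2) (Fin 1)).carrier E)

/-- Elementary: `1 + (m₀ − m₁)² + m₁² + n₀² ≤ 3 · (1 + (m₀² + m₁²) + n₀²)` (the affine re-coding of the torus weight `(m₀, m₁, n₀) = (a+b, b, c)` into the
label `(a, b, c)` costs a factor `3`). [cite: Varadarajan1989, §5.4 Lemma 21] -/
theorem u21_label_sq_le_three_mul_weight_sq (m₀ m₁ n₀ : ℝ) :
    1 + ((m₀ - m₁) ^ 2 + m₁ ^ 2 + n₀ ^ 2) ≤ 3 * (1 + (m₀ ^ 2 + m₁ ^ 2) + n₀ ^ 2) := by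
  nlinarith [sq_nonneg (m₀ + m₁), sq_nonneg m₁, sq_nonneg n₀, sq_nonneg m₀]

/-- **«hq» FOR `U(2,1)` IN THE LABEL OF H4b** (LEAD's contract line, F0P3b-p01 (g2) 2026-08-31T17:25:59Z): for a `K`-irreducible block `W` of smooth vectors of a
unitary strongly continuous `ϖ` of `U(2,1)` (H3a's hypotheses ★ p829889) containing a non-zero integral weight vector of the diagonal torus with weight
`((m₀, m₁), n₀)` — for H4b's block of type `(a, b, c)` this is the highest-weight vector, `(m₀, m₁, n₀) = (a+b, b, c)` — one has
`(1/9) · (1 + (m₀−m₁)² + m₁² + n₀²) ≤ 1 + q_W`, i.e. `δ = 1/9` for the label `(a, b, c) = (m₀ − m₁, m₁, n₀)`.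
[cite: Varadarajan1989, §5.4 Lemma 21] [cite: Knapp1986, Thm. 10.2 (proof)] -/
theorem u21_ninth_mul_one_add_label_sq_le_one_add_upqKBlockScalar (W : Submodule ℂ E) [FiniteDimensional ℂ W] (hu : π.IsUnitary)
    (hc : π.IsStronglyContinuous) (hWs : W ≤ smoothVectors (uFormGroup (Fin 2) (Fin 1)) π)
    (hWK : ∀ (k : (uFormGroup (Fin 2) (Fin 1)).maximalCompact) (v : E), v ∈ W →
      π (Subgroup.inclusion (uFormGroup (Fin 2) (Fin 1)).maximalCompact_le_carrier k) v ∈ W)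
    (hWirr : ∀ W' : Submodule ℂ E, W' ≤ W →
      (∀ (k : (uFormGroup (Fin 2) (Fin 1)).maximalCompact) (v : E), v ∈ W' →
        π (Subgroup.inclusion (uFormGroup (Fin 2) (Fin 1)).maximalCompact_le_carrier k) v ∈ W') → W' = ⊥ ∨ W' = W)
    {v : E} (hv : v ∈ W) (hv0 : v ≠ 0) (m : Fin 2 → ℤ) (n : Fin 1 → ℤ)
    (hw : ∀ (z : Fin 2 → Circle) (z' : Fin 1 → Circle),
      π (RealDualPair.UForm.kV (Fin 2) (Fin 1)
          (Literature.Analysis.SegalBargmann.diagHom z, Literature.Analysis.SegalBargmann.diagHom z')) v =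
        ((∏ l, ((z l : Circle) : ℂ) ^ (m l)) * ∏ l, ((z' l : Circle) : ℂ) ^ (n l)) • v) :
    (9 : ℝ)⁻¹ * (1 + (((m 0 - m 1 : ℤ) : ℝ) ^ 2 + ((m 1 : ℤ) : ℝ) ^ 2 + ((n 0 : ℤ) : ℝ) ^ 2)) ≤
      1 + upqKBlockScalar π W := by
  have h := upq_inv_card_mul_one_add_weight_sq_le_one_add_upqKBlockScalar π W hu hc hWs hWK hWirr hv hv0 m n hw (by simp)
  simp only [Fintype.card_fin, Fin.sum_univ_two, Fin.sum_univ_one, Nat.cast_ofNat, Nat.cast_one] at h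
  have h3 := u21_label_sq_le_three_mul_weight_sq ((m 0 : ℤ) : ℝ) ((m 1 : ℤ) : ℝ) ((n 0 : ℤ) : ℝ)
  push_cast
  nlinarith [h, h3]

end U21



end Literature.NumberTheory.Automorphic

end
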